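import Summits.BirchSwinnertonDyer.BirchSwinnertonDyer.Theorems.ByReductionTypeAtTwoAdditivePotMultConjATwoNarrowTwo469Field
import Summits.BirchSwinnertonDyer.BirchSwinnertonDyer.Theorems.ByReductionTypeAtTwoFineSelmerConjAAtTwoAdditivePotGoodNarrowRankCertificate316LayerOneDyadic
import Summits.BirchSwinnertonDyer.BirchSwinnertonDyer.Theorems.ByReductionTypeAtTwoAdditivePotMultConjATwoNarrowRoadKitSquares
import Literature.NumberTheory.NumberFields.QuadraticExtensionOddClassNumberTwoNonNormUnits
import Literature.NumberTheory.NumberFields.PrincipalPrimeOfResidueFieldFour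
import HarnessLib

/-!
# C4″ `AdditivePotMultOverKAtTwo` (item stmt-BirchSwinnertonDyer-22618), the (I1M′) input of the upper half on the `0 < Δ` rows:
# LAYER-TWO NARROW CERTIFICATE `d = 469` (PQ ROAD, `f(𝔮) = 2`), part DYADIC — the integers `θ, ω, √2` of `A₁ = ℚ(θ) ⊔ ℚ_1 = E(√2)` (`𝓞 A₁ = ℤ[θ,ω]`), its TWO
# dyadic prime elements `π` (`f = 1`) and `η` (`f = 2`, residue field `𝔽₄`; `2 = V·π²η²`), the ring identities of `ℤ[θ,ω]`, and `h(A₁)` ODD (KERNEL; rows 210112ek1)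

Cell `bsd-2adic`, rung K4, seat `bsd-2adic-k4-w3` GEN 15 (explicit unit of director-bsd g16 (309)(7); `--supports stmt-BirchSwinnertonDyer-22618`).
HONEST FRAMING (D-0036/D-0054/D-0152): THEOREMS ONLY (no definition, no named fact, no `sorry`, no instance). The series `…NarrowTwo469{Class, Field,
Dyadic, TotPos, Integers, Parity, SignsW…, Units, Row…}` is the PQ ROAD (residue degree `f(𝔮) = 2`) of the layer-two narrow certificate: in the totally real cubic
`2`-torsion field `E` of discriminant `469` (`X³ + (-1)X² + (-5)X + (4)`, odd discriminant) `2 = u·π_𝔭·π_𝔮` is UNRAMIFIED with `f(𝔭) = 1`, `f(𝔮) = 2`; in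
`A₁ = ℚ(θ) ⊔ ℚ_1 = E(√2)` both ramify: `π_𝔭 = v₁π²` (`|N(π)| = 2`) and `π_𝔮 = v₂η²` (`|N(η)| = 4`, `𝓞/(η) ≅ 𝔽₄` by the tree's `prime_of_absNorm_span_eq_four`),
`2 = V·π²η²`; `h(A₁)` odd by k4-w1's one-bit door (two primes above `2`, a `2`-adic non-norm unit of `E`), `h(A₂)` odd by genus theory for `A₂/A₁` (two ramified primes,
ONE dyadic non-norm unit certified at `π` after multiplication by a norm), `#(U⁺/U²)(A₁) ≥ 2` from one totally positive unit with a residue witness through `A₂`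
(k4-w2's `exists_ringHom_ringOfIntegers_sup_layer_two_zmod'`), ELEVEN sign-independent units of `A₂ = E(√(2+√2))` (with `−1`; `𝓞 A₂ = 𝓞 A₁[e]`), k4-w2's
Edgar–Mollin–Peterson door `a = 1`, `b = 11`, cruxlead-19573-w2's rung `m = 1`; C4″ census rows 210112ek1 (eng-2 CERT-ADD-POTMULT-POS81-AB-E2: `rank₂ Cl⁺ = [0,1,1]`,
`h = 1` at layers `0,1,2`, `2 = 𝔭𝔮` with `f(𝔮) = 2` — letter NARROW-EQUAL12, instrument grade `grh`; here KERNEL). All certificates were found by the seat's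
exact-arithmetic tools (`k4w3/gen15/tools`: `s3explore_pq`, `certpq`, GEN 13/14 `nf12/unitlib`) and are CHECKED HERE by the kernel. Statement (A) is NOT BSD: BSD₂ for
these curves is not proved; C4″ / (I1M′) stay research-open; nothing booked; no row of 22618 changes tier (pen RC-490 (4)); BSD is not proved by any of this.

References: [CoatesSujatha2005] Conj. A, Thm. 3.4; [Fukuda1994] Thm. 1 (2); [EdgarMollinPeterson1986] Thm. 2.1; [FrohlichTaylor1990] Ch. V §1 (1.8)–(1.13);
[Lang1990] Ch. 13 §4 Lemma 4.1; [Washington1997] §13.1, Prop. 13.2; [Cohen1993] §4.1.3, §4.8.2, §6.3; [Marcus1977] Ch. 3 Thm. 27, Ch. 5 Thm. 22; [Omeara1963] §63.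
-/

set_option autoImplicit false
-- sibling precedent: the directory name repeats the summit name
set_option linter.dupNamespace false

noncomputable section

open scoped Classical IntermediateField NumberField nonZeroDivisors Polynomial

namespace Summit.BirchSwinnertonDyer.BirchSwinnertonDyer.Theorems.AddKatoTwo

open Polynomial IsDedekindDomain NumberField Field IntermediateField
  Literature.NumberTheory.EllipticCurves Literature.NumberTheory.EllipticCurves.ZpExtension
  Literature.NumberTheory.IwasawaTheory Literature.NumberTheory.NumberFields
  Literature.NumberTheory.GaloisRepresentations Literature.Geometry.Kaehler.ComplexTorus

variable {θ : AlgebraicClosure ℚ}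

/-- **Ring identities of `ℤ[θ, ω] = 𝓞 A₁`** (`θ³ + (-1)θ² + (-5)θ + (4) = 0`, `ω² = (0)ω + (2)`; `√2 = -ω`): the TWO dyadic prime elements
`π = -4 + ω + θ + θ * ω + θ ^ 2` (`e = 2`, `f = 1`) and `η = 3 - 3 * θ - 2 * θ * ω + θ ^ 2 + θ ^ 2 * ω` (`e = 2`, `f = 2`) of `A₁ = E(√2)`: `π²w = 2 = η²w′` (`w ≡ 1 (π)`), `πμ = 2 + √2 = ημ′` (`μ ≡ 1 (π)`),
`ζ² + ζ + 1 ≡ 0 (mod η)` for `ζ = -θ` (the residue field of `η` is `𝔽₄`), `2 = V·π²η²` (`V` a unit), `π_𝔭(θ) = -2 - θ = v₁π²`, `π_𝔮(θ) = -1 + θ + θ ^ 2 = v₂η²`;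
in any commutative ring. [folklore] [cite: Cohen1993, §4.8.2 and §6.3] -/
theorem layer_one_ids_d469 {R : Type*} [CommRing R] (bA xA : R) (Rb : 4 - 5 * bA - bA ^ 2 + bA ^ 3 = 0) (Rx : xA ^ 2 = (0) * xA + (2)) :
    (((1 : R) * xA) : R) = (0) + (-xA) * (-1) ∧
    (((-4 + xA + bA + bA * xA + bA ^ 2) ^ 2 * (77 + 48 * xA - 5 * bA + 8 * bA * xA - 11 * bA ^ 2 - 12 * bA ^ 2 * xA)) : R) = 2 ∧
    (((-4 + xA + bA + bA * xA + bA ^ 2) * (-1 - 3 * xA - 3 * bA + 2 * bA * xA + bA ^ 2)) : R) = 2 + (-xA) ∧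
    (((77 + 48 * xA - 5 * bA + 8 * bA * xA - 11 * bA ^ 2 - 12 * bA ^ 2 * xA) - 1) : R) = (-4 + xA + bA + bA * xA + bA ^ 2) * (-556 - 436 * xA - 77 * bA + 18 * bA * xA + 129 * bA ^ 2 + 69 * bA ^ 2 * xA) ∧
    (((-1 - 3 * xA - 3 * bA + 2 * bA * xA + bA ^ 2) - 1) : R) = (-4 + xA + bA + bA * xA + bA ^ 2) * (33 + 13 * xA - 12 * bA + 10 * bA * xA - 7 * bA ^ 2 * xA) ∧
    (((3 - 3 * bA - 2 * bA * xA + bA ^ 2 + bA ^ 2 * xA) ^ 2 * (274 + 200 * xA + 16 * bA + 6 * bA * xA - 51 * bA ^ 2 - 40 * bA ^ 2 * xA)) : R) = 2 ∧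
    (((3 - 3 * bA - 2 * bA * xA + bA ^ 2 + bA ^ 2 * xA) * (-6 - 3 * xA + bA - bA * xA + 2 * bA ^ 2)) : R) = 2 + (-xA) ∧
    (((-bA) ^ 2 + (-bA) + 1) : R) = (3 - 3 * bA - 2 * bA * xA + bA ^ 2 + bA ^ 2 * xA) * (-9 - 4 * xA + bA - bA * xA + 3 * bA ^ 2) ∧
    (((18517 + 13104 * xA + 817 * bA + 572 * bA * xA - 3572 * bA ^ 2 - 2536 * bA ^ 2 * xA) * (-4 + xA + bA + bA * xA + bA ^ 2) ^ 2 * (3 - 3 * bA - 2 * bA * xA + bA ^ 2 + bA ^ 2 * xA) ^ 2) : R) = 2 ∧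
    (((18517 + 13104 * xA + 817 * bA + 572 * bA * xA - 3572 * bA ^ 2 - 2536 * bA ^ 2 * xA) * (257 + 112 * xA - 386 * bA - 276 * bA * xA + 145 * bA ^ 2 + 116 * bA ^ 2 * xA)) : R) = 1 ∧
    ((-2 - bA) : R) = (-99 - 72 * xA - 6 * bA - 2 * bA * xA + 19 * bA ^ 2 + 14 * bA ^ 2 * xA) * (-4 + xA + bA + bA * xA + bA ^ 2) ^ 2 ∧
    ((-1 + bA + bA ^ 2) : R) = (35 + 48 * xA + 16 * bA - 8 * bA * xA - 14 * bA ^ 2 * xA) * (3 - 3 * bA - 2 * bA * xA + bA ^ 2 + bA ^ 2 * xA) ^ 2 ∧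
    (((-99 - 72 * xA - 6 * bA - 2 * bA * xA + 19 * bA ^ 2 + 14 * bA ^ 2 * xA) * (1 + 8 * xA - 9 * bA - 6 * bA * xA + 2 * bA ^ 2)) : R) = 1 ∧
    (((35 + 48 * xA + 16 * bA - 8 * bA * xA - 14 * bA ^ 2 * xA) * (43 + 16 * xA - 56 * bA - 40 * bA * xA + 16 * bA ^ 2 + 14 * bA ^ 2 * xA)) : R) = 1 := by
  refine ⟨?_, ?_, ?_, ?_, ?_, ?_, ?_, ?_, ?_, ?_, ?_, ?_, ?_, ?_⟩
  · linear_combination ((0 : R)) * Rx + ((0 : R)) * Rb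
  · linear_combination ((-307 : R) + (48 : R) * xA + (-203 : R) * bA + (104 : R) * bA * xA + (296 : R) * bA ^ 2 + (52 : R) * bA ^ 2 * xA + (173 : R) * bA ^ 3 + (-16 : R) * bA ^ 3 * xA + (-43 : R) * bA ^ 4 + (-12 : R) * bA ^ 4 * xA + (-24 : R) * bA ^ 5) * Rx + ((154 : R) + (62 : R) * xA + (-83 : R) * bA + (-40 : R) * bA * xA + (-86 : R) * bA ^ 2 + (-50 : R) * bA ^ 2 * xA + (-11 : R) * bA ^ 3 + (-12 : R) * bA ^ 3 * xA) * Rb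
  · linear_combination ((-3 : R) + (-1 : R) * bA + (2 : R) * bA ^ 2) * Rx + ((-1 : R) + (3 : R) * xA + (1 : R) * bA) * Rb
  · linear_combination ((436 : R) + (418 : R) * bA + (-87 : R) * bA ^ 2 + (-69 : R) * bA ^ 3) * Rx + ((-319 : R) + (-285 : R) * xA + (-129 : R) * bA + (-69 : R) * bA * xA) * Rb
  · linear_combination ((-13 : R) + (-23 : R) * bA + (-3 : R) * bA ^ 2 + (7 : R) * bA ^ 3) * Rx + ((26 : R) + (4 : R) * xA + (7 : R) * bA * xA) * Rb
  · linear_combination ((-2400 : R) * bA + (4624 : R) * bA ^ 2 + (800 : R) * bA ^ 2 * xA + (-2444 : R) * bA ^ 3 + (-776 : R) * bA ^ 3 * xA + (-374 : R) * bA ^ 4 + (16 : R) * bA ^ 4 * xA + (632 : R) * bA ^ 5 + (166 : R) * bA ^ 5 * xA + (-131 : R) * bA ^ 6 + (-40 : R) * bA ^ 6 * xA) * Rx + ((616 : R) + (450 : R) * xA + (-1627 : R) * bA + (-1146 : R) * bA * xA + (1273 : R) * bA ^ 2 + (898 : R) * bA ^ 2 * xA + (-313 : R) * bA ^ 3 +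 (-222 : R) * bA ^ 3 * xA) * Rb
  · linear_combination ((6 : R) * bA + (-1 : R) * bA ^ 2 + (-1 : R) * bA ^ 3) * Rx + ((-5 : R) + (-2 : R) * xA + (2 : R) * bA + (2 : R) * bA * xA) * Rb
  · linear_combination ((-8 : R) * bA + (2 : R) * bA ^ 2 + (1 : R) * bA ^ 3) * Rx + ((7 : R) + (3 : R) * xA + (-3 : R) * bA + (-3 : R) * bA * xA) * Rb
  · linear_combination ((-3771395 : R) + (-319696 : R) * xA + (142225 : R) * bA + (1965312 : R) * bA * xA + (12477586 : R) * bA ^ 2 + (-157248 : R) * bA * xA ^ 2 + (-896338 : R) * bA ^ 2 * xA + (-8962274 : R) * bA ^ 3 + (-430748 : R) * bA ^ 2 * xA ^ 2 + (-2642528 : R) * bA ^ 3 * xA + (-1236846 : R) * bA ^ 4 + (52416 : R) * bA ^ 2 * xA ^ 3 + (374320 : R) * bA ^ 3 * xA ^ 2 + (2296478 : R) * bA ^ 4 * xA + (3301252 : R) * bA ^ 5 + (54704 : R) * bA ^ 3 * xA ^ 3 + (461709 : R) * bA ^ 4 * xA ^ 2 + (285244 : R) * bA ^ 5 * xA + (-886068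 : R) * bA ^ 6 + (-47168 : R) * bA ^ 4 * xA ^ 3 + (-353341 : R) * bA ^ 5 * xA ^ 2 + (-759638 : R) * bA ^ 6 * xA + (-318900 : R) * bA ^ 7 + (-38068 : R) * bA ^ 5 * xA ^ 3 + (-91201 : R) * bA ^ 6 * xA ^ 2 + (95104 : R) * bA ^ 7 * xA + (173375 : R) * bA ^ 8 + (19568 : R) * bA ^ 6 * xA ^ 3 + (83745 : R) * bA ^ 7 * xA ^ 2 + (78818 : R) * bA ^ 8 * xA + (4961 : R) * bA ^ 9 + (5644 : R) * bA ^ 7 * xA ^ 3 + (2644 : R) * bA ^ 8 * xA ^ 2 + (-11644 : R) * bA ^ 9 * xA + (-8644 : R) * bA ^ 10 + (-2536 : R) * bA ^ 8 * xA ^ 3 + (-5072 : R) * bA ^ 9 * xA ^ 2 + (-2536 : R) * bA ^ 10 * xA) * Rx + ((-1219086 : R) + (-21410 : R) * xA + (-3089863 : R) * bA + (748640 : R) * xA ^ 2 + (-689764 : R) * bA * xA + (3355560 : R) * bA ^ 2 + (109408 : R) * xA ^ 3 + (923418 : R) * bA * xA ^ 2 + (1525290 : R) * bA ^ 2 * xA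 + (-700643 : R) * bA ^ 3 + (-94336 : R) * bA * xA ^ 3 + (-706682 : R) * bA ^ 2 * xA ^ 2 + (-831892 : R) * bA ^ 3 * xA + (-499019 : R) * bA ^ 4 + (-76136 : R) * bA ^ 2 * xA ^ 3 + (-182402 : R) * bA ^ 3 * xA ^ 2 + (-138518 : R) * bA ^ 4 * xA + (276154 : R) * bA ^ 5 + (39136 : R) * bA ^ 3 * xA ^ 3 + (167490 : R) * bA ^ 4 * xA ^ 2 + (212928 : R) * bA ^ 5 * xA + (4167 : R) * bA ^ 6 + (11288 : R) * bA ^ 4 * xA ^ 3 + (5288 : R) * bA ^ 5 * xA ^ 2 + (-11402 : R) * bA ^ 6 * xA + (-20860 : R) * bA ^ 7 + (-5072 : R) * bA ^ 5 * xA ^ 3 + (-10144 : R) * bA ^ 6 * xA ^ 2 + (-14752 : R) * bA ^ 7 * xA) * Rb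
  · linear_combination ((1467648 : R) + (-3552640 : R) * bA + (1078160 : R) * bA ^ 2 + (766288 : R) * bA ^ 3 + (-294176 : R) * bA ^ 4) * Rx + ((1923541 : R) + (1360408 : R) * xA + (-1106292 : R) * bA + (-782072 : R) * bA * xA) * Rb
  · linear_combination ((-477 : R) + (72 : R) * xA + (-244 : R) * bA + (146 : R) * bA * xA + (480 : R) * bA ^ 2 + (62 : R) * bA ^ 2 * xA + (204 : R) * bA ^ 3 + (-26 : R) * bA ^ 3 * xA + (-71 : R) * bA ^ 4 + (-14 : R) * bA ^ 4 * xA + (-28 : R) * bA ^ 5) * Rx + ((157 : R) + (126 : R) * xA + (-100 : R) * bA + (-66 : R) * bA * xA + (-107 : R) * bA ^ 2 + (-78 : R) * bA ^ 2 * xA + (-19 : R) * bA ^ 3 + (-14 : R) * bA ^ 3 * xA) * Rb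
  · linear_combination ((576 : R) * bA + (-1100 : R) * bA ^ 2 + (-192 : R) * bA ^ 2 * xA + (532 : R) * bA ^ 3 + (224 : R) * bA ^ 3 * xA + (105 : R) * bA ^ 4 + (-24 : R) * bA ^ 4 * xA + (-140 : R) * bA ^ 5 + (-48 : R) * bA ^ 5 * xA + (28 : R) * bA ^ 6 + (14 : R) * bA ^ 6 * xA) * Rx + ((-79 : R) + (-108 : R) * xA + (311 : R) * bA + (204 : R) * bA * xA + (-240 : R) * bA ^ 2 + (-162 : R) * bA ^ 2 * xA + (56 : R) * bA ^ 3 + (42 : R) * bA ^ 3 * xA) * Rb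
  · linear_combination ((-576 : R) + (416 : R) * bA + (124 : R) * bA ^ 2 + (-84 : R) * bA ^ 3) * Rx + ((-313 : R) + (-216 : R) * xA + (38 : R) * bA + (28 : R) * bA * xA) * Rb
  · linear_combination ((768 : R) + (-2048 : R) * bA + (768 : R) * bA ^ 2 + (448 : R) * bA ^ 3 + (-196 : R) * bA ^ 4) * Rx + ((760 : R) + (656 : R) * xA + (-392 : R) * bA + (-224 : R) * bA * xA) * Rb

/-- **Ring identities for the units of `ℤ[θ, ω]` used downstream**: inverse of `ε = -1 + θ` and its dyadic NON-NORM certificate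
`ε·(a² − (2+√2)b²) − 1 = π⁴κ`, `κ ≡ 1 (mod π)` (Hilbert symbol `(ε, 2+√2)_π = −1` after multiplying by a NORM); inverse of the totally positive unit
`u = 9 - 14 * ω + 6 * θ + 2 * θ * ω + θ ^ 2 + 4 * θ ^ 2 * ω`. [folklore] -/
theorem layer_one_unit_ids_d469 {R : Type*} [CommRing R] (bA xA : R) (Rb : 4 - 5 * bA - bA ^ 2 + bA ^ 3 = 0) (Rx : xA ^ 2 = (0) * xA + (2)) :
    (((-1 + bA) * (-5 + bA ^ 2)) : R) = 1 ∧
    (((-1 + bA) * ((-1 + xA) ^ 2 - (2 + (-xA)) * (xA) ^ 2) - 1) : R) = (-4 + xA + bA + bA * xA + bA ^ 2) ^ 4 * (-1665 - 1456 * xA - 418 * bA + 180 * bA * xA + 465 * bA ^ 2 + 180 * bA ^ 2 * xA) ∧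
    (((-1665 - 1456 * xA - 418 * bA + 180 * bA * xA + 465 * bA ^ 2 + 180 * bA ^ 2 * xA) - 1) : R) = (-4 + xA + bA + bA * xA + bA ^ 2) * (16368 + 9911 * xA - 1348 * bA + 1896 * bA * xA - 2297 * bA ^ 2 - 2527 * bA ^ 2 * xA) ∧
    (((9 - 14 * xA + 6 * bA + 2 * bA * xA + bA ^ 2 + 4 * bA ^ 2 * xA) * (1141 + 806 * xA + 49 * bA + 36 * bA * xA - 220 * bA ^ 2 - 156 * bA ^ 2 * xA)) : R) = 1 := by
  refine ⟨?_, ?_, ?_, ?_⟩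
  · linear_combination ((0 : R)) * Rx + ((1 : R)) * Rb
  · linear_combination ((-517245 : R) + (83855 : R) * xA + (225627 : R) * bA + (-21631 : R) * xA ^ 2 + (166717 : R) * bA * xA + (789654 : R) * bA ^ 2 + (1456 : R) * xA ^ 3 + (-54106 : R) * bA * xA ^ 2 + (-141104 : R) * bA ^ 2 * xA + (-168098 : R) * bA ^ 3 + (5644 : R) * bA * xA ^ 3 + (-24595 : R) * bA ^ 2 * xA ^ 2 + (-180924 : R) * bA ^ 3 * xA + (-341584 : R) * bA ^ 4 + (7836 : R) * bA ^ 2 * xA ^ 3 + (32636 : R) * bA ^ 3 * xA ^ 2 + (52952 : R) * bA ^ 4 * xA + (54150 : R) * bA ^ 5 + (4024 : R) * bA ^ 3 * xA ^ 3 + (28163 : R) * bA ^ 4 * xA ^ 2 + (67972 : R) * bA ^ 5 * xA + (74818 : R) * bA ^ 6 + (-344 : R) * bA ^ 4 * xA ^ 3 + (62 : R) * bA ^ 5 * xA ^ 2 + (808 : R) * bA ^ 6 * xA + (-1388 : R) * bA ^ 7 + (-900 : R) * bA ^ 5 * xA ^ 3 + (-4065 : R) * bA ^ 6 * xA ^ 2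 + (-7260 : R) * bA ^ 7 * xA + (-6390 : R) * bA ^ 8 + (-180 : R) * bA ^ 6 * xA ^ 3 + (-720 : R) * bA ^ 7 * xA ^ 2 + (-1080 : R) * bA ^ 8 * xA + (-720 : R) * bA ^ 9) * Rx + ((-152063 : R) + (28552 : R) * xA + (-157073 : R) * bA + (65272 : R) * xA ^ 2 + (-39048 : R) * bA * xA + (37358 : R) * bA ^ 2 + (8048 : R) * xA ^ 3 + (56326 : R) * bA * xA ^ 2 + (-7532 : R) * bA ^ 2 * xA + (47696 : R) * bA ^ 3 + (-688 : R) * bA * xA ^ 3 + (124 : R) * bA ^ 2 * xA ^ 2 + (30204 : R) * bA ^ 3 * xA + (-5176 : R) * bA ^ 4 + (-1800 : R) * bA ^ 2 * xA ^ 3 + (-8130 : R) * bA ^ 3 * xA ^ 2 + (2320 : R) * bA ^ 4 * xA + (-10465 : R) * bA ^ 5 + (-360 : R) * bA ^ 3 * xA ^ 3 + (-1440 : R) * bA ^ 4 * xA ^ 2 + (-9232 : R) * bA ^ 5 * xA + (-3347 : R) * bA ^ 6 + (-2940 : R) * bA ^ 6 * xA + (-465 : R) * bA ^ 7 + (-180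 : R) * bA ^ 7 * xA) * Rb
  · linear_combination ((-9911 : R) + (-11807 : R) * bA + (631 : R) * bA ^ 2 + (2527 : R) * bA ^ 3) * Rx + ((10996 : R) + (5455 : R) * xA + (2297 : R) * bA + (2527 : R) * bA * xA) * Rb
  · linear_combination ((-11284 : R) + (1108 : R) * bA + (5480 : R) * bA ^ 2 + (-168 : R) * bA ^ 3 + (-624 : R) * bA ^ 4) * Rx + ((-3075 : R) + (-2180 : R) * xA + (-1468 : R) * bA + (-1036 : R) * bA * xA) * Rb

set_option linter.unusedSimpArgs false in
set_option maxHeartbeats 3200000 in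
/-- **The integers `b = θ`, `ω = ((0) + t * (-1))`, `t = √2` of `A₁ = ℚ(θ) ⊔ ℚ_1 = E(√2)` (`θ³ + (-1)θ² + (-5)θ + (4) = 0`, `d = 469` odd: `2 = u·π_𝔭·π_𝔮` in `E` with `f(𝔮) = 2`)
and the TWO dyadic prime ELEMENTS of `A₁`**: `π` (`|N(π)| = 2`, relative norm `a² − 2b²` then the cubic norm form; residues `{0,1}`, `π ∤ w`, `π ∤ μ`) and `η` (`|N(η)| = 4`,
`η ∣ 2`, `ζ² + ζ + 1 ≡ 0 (mod η)` ⇒ `𝓞/(η) ≅ 𝔽₄`, PRIME by the tree's `prime_of_absNorm_span_eq_four`). KERNEL. [cite: Cohen1993, §4.8.2 and §6.3] [cite: Marcus1977, Ch. 3 Thm. 27]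
[cite: Omeara1963, §63B (63:10)] -/
theorem layer_one_dyadic_d469 (hθ : aeval θ (Cubic.toPoly ⟨1, ((-1 : ℤ) : ℚ), ((-5 : ℤ) : ℚ), ((4 : ℤ) : ℚ)⟩) = 0)
    {t : AlgebraicClosure ℚ} (ht : t ∈ (CyclotomicZp.zpExtension 2).layer 1) (ht2 : t ^ 2 = 2) :
    haveI : FiniteDimensional ℚ ↥ℚ⟮θ⟯ :=
      IntermediateField.adjoin.finiteDimensional ⟨_, Cubic.monic_of_a_eq_one', by rwa [← aeval_def]⟩
    haveI : FiniteDimensional ℚ ↥((CyclotomicZp.zpExtension 2).layer 1) := (CyclotomicZp.zpExtension 2).finiteDimensional_layer_holds 1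
    ∃ bA xA sA : 𝓞 ↥(ℚ⟮θ⟯ ⊔ (CyclotomicZp.zpExtension 2).layer 1),
      (bA : ↥(ℚ⟮θ⟯ ⊔ (CyclotomicZp.zpExtension 2).layer 1)) = inclusion (le_sup_left : ℚ⟮θ⟯ ≤ ℚ⟮θ⟯ ⊔ (CyclotomicZp.zpExtension 2).layer 1) (AdjoinSimple.gen ℚ θ) ∧
      (sA : ↥(ℚ⟮θ⟯ ⊔ (CyclotomicZp.zpExtension 2).layer 1)) = ⟨t, (le_sup_right : (CyclotomicZp.zpExtension 2).layer 1 ≤ _) ht⟩ ∧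
      (xA : ↥(ℚ⟮θ⟯ ⊔ (CyclotomicZp.zpExtension 2).layer 1)) = ((0) + (⟨t, (le_sup_right : (CyclotomicZp.zpExtension 2).layer 1 ≤ _) ht⟩ : ↥(ℚ⟮θ⟯ ⊔ (CyclotomicZp.zpExtension 2).layer 1)) * (-1)) ∧
      4 - 5 * bA - bA ^ 2 + bA ^ 3 = 0 ∧ xA ^ 2 = (0) * xA + (2) ∧ -xA = sA ∧ sA ^ 2 = 2 ∧
      (Prime (-4 + xA + bA + bA * xA + bA ^ 2) ∧ (∀ z : 𝓞 ↥(ℚ⟮θ⟯ ⊔ (CyclotomicZp.zpExtension 2).layer 1), (-4 + xA + bA + bA * xA + bA ^ 2) ∣ z ∨ (-4 + xA + bA + bA * xA + bA ^ 2) ∣ z - 1) ∧ ¬ (-4 + xA + bA + bA * xA + bA ^ 2) ∣ (77 + 48 * xA - 5 * bA + 8 * bA * xA - 11 * bA ^ 2 - 12 * bA ^ 2 * xA) ∧ ¬ (-4 + xA + bA + bA * xA + bA ^ 2) ∣ (-1 - 3 * xA - 3 * bA + 2 * bA * xA + bA ^ 2) ∧ (Ideal.span {-4 + xA + bA + bA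 * xA + bA ^ 2}).IsPrime) ∧
      (Prime (3 - 3 * bA - 2 * bA * xA + bA ^ 2 + bA ^ 2 * xA) ∧ (Ideal.span {3 - 3 * bA - 2 * bA * xA + bA ^ 2 + bA ^ 2 * xA}).IsPrime) := by
  haveI : FiniteDimensional ℚ ↥ℚ⟮θ⟯ :=
    IntermediateField.adjoin.finiteDimensional ⟨_, Cubic.monic_of_a_eq_one', by rwa [← aeval_def]⟩
  haveI : FiniteDimensional ℚ ↥((CyclotomicZp.zpExtension 2).layer 1) := (CyclotomicZp.zpExtension 2).finiteDimensional_layer_holds 1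
  haveI : NumberField ↥ℚ⟮θ⟯ := NumberField.mk
  haveI : NumberField ↥(ℚ⟮θ⟯ ⊔ (CyclotomicZp.zpExtension 2).layer 1) := NumberField.mk
  obtain ⟨hrealA, hfinA, h3⟩ := layer_one_basics irreducible_cubic_d469p hθ (isTotallyReal_adjoin_d469p hθ)
  have hKA : ℚ⟮θ⟯ ≤ ℚ⟮θ⟯ ⊔ (CyclotomicZp.zpExtension 2).layer 1 := le_sup_left
  have htA : t ∈ ℚ⟮θ⟯ ⊔ (CyclotomicZp.zpExtension 2).layer 1 := (le_sup_right : (CyclotomicZp.zpExtension 2).layer 1 ≤ _) ht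
  set t' : ↥(ℚ⟮θ⟯ ⊔ (CyclotomicZp.zpExtension 2).layer 1) := ⟨t, htA⟩ with ht'def
  have ht'2 : t' ^ 2 = 2 := by
    apply (algebraMap ↥(ℚ⟮θ⟯ ⊔ (CyclotomicZp.zpExtension 2).layer 1) (AlgebraicClosure ℚ)).injective
    rw [map_pow, map_ofNat]
    exact ht2
  letI : Algebra ↥ℚ⟮θ⟯ ↥(ℚ⟮θ⟯ ⊔ (CyclotomicZp.zpExtension 2).layer 1) := (inclusion hKA).toRingHom.toAlgebra
  have halg : ∀ c : ↥ℚ⟮θ⟯, algebraMap ↥ℚ⟮θ⟯ ↥(ℚ⟮θ⟯ ⊔ (CyclotomicZp.zpExtension 2).layer 1) c = inclusion hKA c := fun _ => rfl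
  haveI : IsScalarTower ℚ ↥ℚ⟮θ⟯ ↥(ℚ⟮θ⟯ ⊔ (CyclotomicZp.zpExtension 2).layer 1) :=
    IsScalarTower.of_algebraMap_eq fun q => ((inclusion hKA).commutes q).symm
  haveI : Module.Finite ↥ℚ⟮θ⟯ ↥(ℚ⟮θ⟯ ⊔ (CyclotomicZp.zpExtension 2).layer 1) := Module.Finite.of_restrictScalars_finite ℚ ↥ℚ⟮θ⟯ _
  have hdeg : Module.finrank ↥ℚ⟮θ⟯ ↥(ℚ⟮θ⟯ ⊔ (CyclotomicZp.zpExtension 2).layer 1) = 2 := by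
    have htower := Module.finrank_mul_finrank ℚ ↥ℚ⟮θ⟯ ↥(ℚ⟮θ⟯ ⊔ (CyclotomicZp.zpExtension 2).layer 1)
    rw [h3, hfinA] at htower
    omega
  haveI : Algebra.IsQuadraticExtension ↥ℚ⟮θ⟯ ↥(ℚ⟮θ⟯ ⊔ (CyclotomicZp.zpExtension 2).layer 1) := ⟨hdeg⟩
  haveI : IsGalois ↥ℚ⟮θ⟯ ↥(ℚ⟮θ⟯ ⊔ (CyclotomicZp.zpExtension 2).layer 1) := inferInstance
  have hsK : t' ∉ Set.range (algebraMap ↥ℚ⟮θ⟯ ↥(ℚ⟮θ⟯ ⊔ (CyclotomicZp.zpExtension 2).layer 1)) :=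
    sqrt_two_not_mem_range irreducible_cubic_d469p hθ (isTotallyReal_adjoin_d469p hθ) ht ht2
  have ht'2K : t' ^ 2 = algebraMap ↥ℚ⟮θ⟯ ↥(ℚ⟮θ⟯ ⊔ (CyclotomicZp.zpExtension 2).layer 1) 2 := by rw [ht'2, map_ofNat]
  obtain ⟨b, hbθ, hb⟩ := exists_ringOfIntegers_cubic_root (p := -1) (q := -5) (r := 4) hθ
  have hb' : 4 - 5 * b - b ^ 2 + b ^ 3 = 0 := by push_cast at hb; linear_combination hb
  have hbgen : algebraMap (𝓞 ↥ℚ⟮θ⟯) ↥ℚ⟮θ⟯ b = AdjoinSimple.gen ℚ θ := Subtype.ext hbθ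
  have hbgen' : (b : ↥ℚ⟮θ⟯) = AdjoinSimple.gen ℚ θ := Subtype.ext hbθ
  have hgenrel : 4 - 5 * (AdjoinSimple.gen ℚ θ) - (AdjoinSimple.gen ℚ θ) ^ 2 + (AdjoinSimple.gen ℚ θ) ^ 3 = (0 : ↥ℚ⟮θ⟯) := by
    have h := congrArg (algebraMap (𝓞 ↥ℚ⟮θ⟯) ↥ℚ⟮θ⟯) hb'
    simp only [map_add, map_sub, map_mul, map_pow, map_zero, map_ofNat, map_neg, map_one, hbgen] at h; exact h
  set θ' : ↥(ℚ⟮θ⟯ ⊔ (CyclotomicZp.zpExtension 2).layer 1) := inclusion hKA (AdjoinSimple.gen ℚ θ) with hθ'def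
  set bA : 𝓞 ↥(ℚ⟮θ⟯ ⊔ (CyclotomicZp.zpExtension 2).layer 1) := algebraMap (𝓞 ↥ℚ⟮θ⟯) (𝓞 ↥(ℚ⟮θ⟯ ⊔ (CyclotomicZp.zpExtension 2).layer 1)) b with hbAdef
  have RbA : 4 - 5 * bA - bA ^ 2 + bA ^ 3 = 0 := by
    have h := congrArg (algebraMap (𝓞 ↥ℚ⟮θ⟯) (𝓞 ↥(ℚ⟮θ⟯ ⊔ (CyclotomicZp.zpExtension 2).layer 1))) hb'
    simp only [map_add, map_sub, map_mul, map_pow, map_zero, map_ofNat, map_zero, map_neg] at h; exact h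
  have hbAval : algebraMap (𝓞 ↥(ℚ⟮θ⟯ ⊔ (CyclotomicZp.zpExtension 2).layer 1)) ↥(ℚ⟮θ⟯ ⊔ (CyclotomicZp.zpExtension 2).layer 1) bA = θ' := by
    rw [hbAdef, hθ'def, ← IsScalarTower.algebraMap_apply,
      IsScalarTower.algebraMap_apply (𝓞 ↥ℚ⟮θ⟯) ↥ℚ⟮θ⟯ ↥(ℚ⟮θ⟯ ⊔ (CyclotomicZp.zpExtension 2).layer 1), hbgen, halg]
  have hbAval' : (bA : ↥(ℚ⟮θ⟯ ⊔ (CyclotomicZp.zpExtension 2).layer 1)) = θ' := hbAval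
  have hθ'rel : 4 - 5 * θ' - θ' ^ 2 + θ' ^ 3 = 0 := by
    have h := congrArg (algebraMap (𝓞 ↥(ℚ⟮θ⟯ ⊔ (CyclotomicZp.zpExtension 2).layer 1)) ↥(ℚ⟮θ⟯ ⊔ (CyclotomicZp.zpExtension 2).layer 1)) RbA
    simp only [map_add, map_sub, map_mul, map_pow, map_zero, map_ofNat, map_zero, map_neg, hbAval] at h; exact h
  set ω' : ↥(ℚ⟮θ⟯ ⊔ (CyclotomicZp.zpExtension 2).layer 1) := ((0) + t' * (-1)) with hω'def
  have hωsq : ω' ^ 2 = (0) * ω' + (2) := by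
    rw [hω'def]
    linear_combination ((1 : ↥(ℚ⟮θ⟯ ⊔ (CyclotomicZp.zpExtension 2).layer 1))) * ht'2 + ((0 : ↥(ℚ⟮θ⟯ ⊔ (CyclotomicZp.zpExtension 2).layer 1))) * hθ'rel
  have hωint : IsIntegral ℤ ω' := by
    refine isIntegral_of_monic_sextic_eval ω' (-8) (0) (12) (0) (-6) (0) ?_
    rw [hω'def]
    push_cast
    linear_combination ((4 : ↥(ℚ⟮θ⟯ ⊔ (CyclotomicZp.zpExtension 2).layer 1)) + (-4 : ↥(ℚ⟮θ⟯ ⊔ (CyclotomicZp.zpExtension 2).layer 1)) * t' ^ 2 + (1 : ↥(ℚ⟮θ⟯ ⊔ (CyclotomicZp.zpExtension 2).layer 1)) * t' ^ 4) * ht'2 + ((0 : ↥(ℚ⟮θ⟯ ⊔ (CyclotomicZp.zpExtension 2).layer 1))) * hθ'rel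
  set xA : 𝓞 ↥(ℚ⟮θ⟯ ⊔ (CyclotomicZp.zpExtension 2).layer 1) := ⟨ω', hωint⟩ with hxAdef
  have hxAval : algebraMap (𝓞 ↥(ℚ⟮θ⟯ ⊔ (CyclotomicZp.zpExtension 2).layer 1)) ↥(ℚ⟮θ⟯ ⊔ (CyclotomicZp.zpExtension 2).layer 1) xA = ω' := rfl
  have RxA : xA ^ 2 = (0) * xA + (2) := by
    apply NumberField.RingOfIntegers.coe_injective
    simp only [map_add, map_sub, map_mul, map_pow, map_zero, map_ofNat, map_neg, map_one, hxAval, hbAval]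
    linear_combination hωsq
  have hsint : IsIntegral ℤ t' := ⟨X ^ 2 - C 2, monic_X_pow_sub_C _ two_ne_zero, by simp [ht'2]⟩
  set sA : 𝓞 ↥(ℚ⟮θ⟯ ⊔ (CyclotomicZp.zpExtension 2).layer 1) := ⟨t', hsint⟩ with hsAdef
  have hsAval : algebraMap (𝓞 ↥(ℚ⟮θ⟯ ⊔ (CyclotomicZp.zpExtension 2).layer 1)) ↥(ℚ⟮θ⟯ ⊔ (CyclotomicZp.zpExtension 2).layer 1) sA = t' := rfl
  have hs : -xA = sA := by
    apply NumberField.RingOfIntegers.coe_injective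
    simp only [map_add, map_sub, map_mul, map_pow, map_zero, map_ofNat, map_neg, map_one, hxAval, hbAval, hsAval]
    rw [hω'def]
    linear_combination ((0 : ↥(ℚ⟮θ⟯ ⊔ (CyclotomicZp.zpExtension 2).layer 1))) * ht'2 + ((0 : ↥(ℚ⟮θ⟯ ⊔ (CyclotomicZp.zpExtension 2).layer 1))) * hθ'rel
  have hsA2 : sA ^ 2 = 2 := by
    apply NumberField.RingOfIntegers.coe_injective
    rw [map_pow, hsAval, ht'2, map_ofNat]
  obtain ⟨-, -, -, hw1_1, hmu1_1, -, -, hzeta, htwoall, -, -, -, -, -⟩ := layer_one_ids_d469 bA xA RbA RxA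
  haveI : Module.Free ↥ℚ⟮θ⟯ ↥(ℚ⟮θ⟯ ⊔ (CyclotomicZp.zpExtension 2).layer 1) := Module.Free.of_divisionRing _ _
  have hcardq : Nat.card (𝓞 ↥(ℚ⟮θ⟯ ⊔ (CyclotomicZp.zpExtension 2).layer 1) ⧸ Ideal.span {(1 : 𝓞 ↥(ℚ⟮θ⟯ ⊔ (CyclotomicZp.zpExtension 2).layer 1))}) = 1 := by
    rw [Ideal.span_singleton_one, ← Submodule.cardQuot_apply, ← Ideal.absNorm_apply, Ideal.absNorm_top]
  have prime_pack : ∀ π : 𝓞 ↥(ℚ⟮θ⟯ ⊔ (CyclotomicZp.zpExtension 2).layer 1), (Algebra.norm ℤ π).natAbs = 2 →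
      Prime π ∧ (∀ z : 𝓞 ↥(ℚ⟮θ⟯ ⊔ (CyclotomicZp.zpExtension 2).layer 1), π ∣ z ∨ π ∣ z - 1) ∧ (Ideal.span {π}).IsPrime := by
    intro π hNπ
    have habsπ : Ideal.absNorm (Ideal.span {π}) = 2 := by rw [Ideal.absNorm_span_singleton, hNπ]
    have hPπ : (Ideal.span {π}).IsPrime := Ideal.isPrime_of_irreducible_absNorm (by rw [habsπ]; exact Nat.prime_two)
    have hπ0 : π ≠ 0 := by
      intro h0; rw [h0, Algebra.norm_zero] at hNπ; norm_num at hNπ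
    have hprime : Prime π := (Ideal.span_singleton_prime hπ0).mp hPπ
    have hcard : Nat.card (𝓞 ↥(ℚ⟮θ⟯ ⊔ (CyclotomicZp.zpExtension 2).layer 1) ⧸ Ideal.span {π}) = 2 := by
      rw [← Submodule.cardQuot_apply, ← Ideal.absNorm_apply, habsπ]
    refine ⟨hprime, fun z => ?_, hPπ⟩
    by_cases hz : Ideal.Quotient.mk (Ideal.span {π}) z = 0
    · exact Or.inl (Ideal.mem_span_singleton.mp (Ideal.Quotient.eq_zero_iff_mem.mp hz))
    · right
      have h10 : (1 : 𝓞 ↥(ℚ⟮θ⟯ ⊔ (CyclotomicZp.zpExtension 2).layer 1) ⧸ Ideal.span {π}) ≠ 0 := by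
        haveI : Nontrivial (𝓞 ↥(ℚ⟮θ⟯ ⊔ (CyclotomicZp.zpExtension 2).layer 1) ⧸ Ideal.span {π}) := Ideal.Quotient.nontrivial_iff.mpr hPπ.ne_top
        exact one_ne_zero
      obtain ⟨y, -, huniq⟩ := (Nat.card_eq_two_iff' (0 : 𝓞 ↥(ℚ⟮θ⟯ ⊔ (CyclotomicZp.zpExtension 2).layer 1) ⧸ Ideal.span {π})).mp hcard
      have h1 : Ideal.Quotient.mk (Ideal.span {π}) z = 1 := (huniq _ hz).trans (huniq _ h10).symm
      have h0 : Ideal.Quotient.mk (Ideal.span {π}) (z - 1) = 0 := by rw [map_sub, h1, map_one, sub_self]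
      exact Ideal.mem_span_singleton.mp (Ideal.Quotient.eq_zero_iff_mem.mp h0)
  -- norms `|N(πₖ)| = 2`: `N_{A₁/E}(πₖ) = aₖ² − 2bₖ² = nₖ(θ)` with `|N_{E/ℚ}(nₖ)| = 2`
  have hnorm : ∀ (π : 𝓞 ↥(ℚ⟮θ⟯ ⊔ (CyclotomicZp.zpExtension 2).layer 1)) (a_ c_ : ↥ℚ⟮θ⟯) (w_ : 𝓞 ↥ℚ⟮θ⟯),
      (π : ↥(ℚ⟮θ⟯ ⊔ (CyclotomicZp.zpExtension 2).layer 1)) = algebraMap ↥ℚ⟮θ⟯ ↥(ℚ⟮θ⟯ ⊔ (CyclotomicZp.zpExtension 2).layer 1) a_ + algebraMap ↥ℚ⟮θ⟯ ↥(ℚ⟮θ⟯ ⊔ (CyclotomicZp.zpExtension 2).layer 1) c_ * t' →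
      a_ ^ 2 - 2 * c_ ^ 2 = (w_ : ↥ℚ⟮θ⟯) → ∀ m_ : ℕ, (Algebra.norm ℤ w_).natAbs = m_ → (Algebra.norm ℤ π).natAbs = m_ := by
    intro π a_ c_ w_ hπ hac m_ hN
    have hrel : Algebra.norm ↥ℚ⟮θ⟯ (π : ↥(ℚ⟮θ⟯ ⊔ (CyclotomicZp.zpExtension 2).layer 1)) = a_ ^ 2 - 2 * c_ ^ 2 := by
      rw [hπ]; exact AmbiguousClass.norm_algebraMap_add_mul_eq hdeg ht'2K hsK a_ c_
    have h1 : (Algebra.norm ℤ π : ℚ) = (Algebra.norm ℤ w_ : ℚ) := by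
      rw [Algebra.coe_norm_int, Algebra.coe_norm_int, ← Algebra.norm_norm (R := ℚ) (S := ↥ℚ⟮θ⟯) (a := (π : ↥(ℚ⟮θ⟯ ⊔ (CyclotomicZp.zpExtension 2).layer 1))), hrel, hac]
    have h2 : Algebra.norm ℤ π = Algebra.norm ℤ w_ := by exact_mod_cast h1
    rw [h2]; exact hN
  have hπ1val : ((-4 + xA + bA + bA * xA + bA ^ 2 : 𝓞 ↥(ℚ⟮θ⟯ ⊔ (CyclotomicZp.zpExtension 2).layer 1)) : ↥(ℚ⟮θ⟯ ⊔ (CyclotomicZp.zpExtension 2).layer 1)) = algebraMap ↥ℚ⟮θ⟯ ↥(ℚ⟮θ⟯ ⊔ (CyclotomicZp.zpExtension 2).layer 1) ((-4 + (AdjoinSimple.gen ℚ θ) + (AdjoinSimple.gen ℚ θ) ^ 2) : ↥ℚ⟮θ⟯) + algebraMap ↥ℚ⟮θ⟯ ↥(ℚ⟮θ⟯ ⊔ (CyclotomicZp.zpExtension 2).layer 1) ((-1 - (AdjoinSimple.gen ℚ θ)) : ↥ℚ⟮θ⟯) * t' := by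
    rw [NumberField.RingOfIntegers.coe_eq_algebraMap]
    simp only [map_add, map_sub, map_mul, map_pow, map_zero, map_ofNat, map_neg, map_one, map_div₀, map_intCast, map_natCast, hxAval, hbAval, halg, hθ'def.symm]
    rw [hω'def]
    linear_combination ((0 : ↥(ℚ⟮θ⟯ ⊔ (CyclotomicZp.zpExtension 2).layer 1))) * ht'2 + ((0 : ↥(ℚ⟮θ⟯ ⊔ (CyclotomicZp.zpExtension 2).layer 1))) * hθ'rel
  have hn1 : ((-4 + (AdjoinSimple.gen ℚ θ) + (AdjoinSimple.gen ℚ θ) ^ 2) : ↥ℚ⟮θ⟯) ^ 2 - 2 * ((-1 - (AdjoinSimple.gen ℚ θ)) : ↥ℚ⟮θ⟯) ^ 2 = (((((2 : ℤ) : 𝓞 ↥ℚ⟮θ⟯) + ((-1 : ℤ) : 𝓞 ↥ℚ⟮θ⟯) * b + ((-1 : ℤ) : 𝓞 ↥ℚ⟮θ⟯) * b ^ 2) : 𝓞 ↥ℚ⟮θ⟯) : ↥ℚ⟮θ⟯) := by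
    rw [NumberField.RingOfIntegers.coe_eq_algebraMap]
    simp only [map_add, map_sub, map_mul, map_pow, map_intCast, map_neg, map_one, map_zero, hbgen]
    push_cast
    linear_combination ((3 : ↥ℚ⟮θ⟯) + (1 : ↥ℚ⟮θ⟯) * (AdjoinSimple.gen ℚ θ)) * hgenrel
  have hNw1 : (Algebra.norm ℤ ((((2 : ℤ) : 𝓞 ↥ℚ⟮θ⟯) + ((-1 : ℤ) : 𝓞 ↥ℚ⟮θ⟯) * b + ((-1 : ℤ) : 𝓞 ↥ℚ⟮θ⟯) * b ^ 2) : 𝓞 ↥ℚ⟮θ⟯)).natAbs = 2 := by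
    rw [natAbs_norm_coords_eq_natAbs_normPoly ↥ℚ⟮θ⟯ h3 b (p := -1) (q := -5) (r := 4) irreducible_cubic_d469p hb (2) (-1) (-1)]; norm_num
  have hN1 : (Algebra.norm ℤ (-4 + xA + bA + bA * xA + bA ^ 2 : 𝓞 ↥(ℚ⟮θ⟯ ⊔ (CyclotomicZp.zpExtension 2).layer 1))).natAbs = 2 := hnorm _ _ _ _ hπ1val hn1 2 hNw1
  have hπ2val : ((3 - 3 * bA - 2 * bA * xA + bA ^ 2 + bA ^ 2 * xA : 𝓞 ↥(ℚ⟮θ⟯ ⊔ (CyclotomicZp.zpExtension 2).layer 1)) : ↥(ℚ⟮θ⟯ ⊔ (CyclotomicZp.zpExtension 2).layer 1)) = algebraMap ↥ℚ⟮θ⟯ ↥(ℚ⟮θ⟯ ⊔ (CyclotomicZp.zpExtension 2).layer 1) ((3 - 3 * (AdjoinSimple.gen ℚ θ) + (AdjoinSimple.gen ℚ θ) ^ 2) : ↥ℚ⟮θ⟯) + algebraMap ↥ℚ⟮θ⟯ ↥(ℚ⟮θ⟯ ⊔ (CyclotomicZp.zpExtension 2).layer 1) ((2 * (AdjoinSimple.gen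 ℚ θ) - (AdjoinSimple.gen ℚ θ) ^ 2) : ↥ℚ⟮θ⟯) * t' := by
    rw [NumberField.RingOfIntegers.coe_eq_algebraMap]
    simp only [map_add, map_sub, map_mul, map_pow, map_zero, map_ofNat, map_neg, map_one, map_div₀, map_intCast, map_natCast, hxAval, hbAval, halg, hθ'def.symm]
    rw [hω'def]
    linear_combination ((0 : ↥(ℚ⟮θ⟯ ⊔ (CyclotomicZp.zpExtension 2).layer 1))) * ht'2 + ((0 : ↥(ℚ⟮θ⟯ ⊔ (CyclotomicZp.zpExtension 2).layer 1))) * hθ'rel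
  have hn2 : ((3 - 3 * (AdjoinSimple.gen ℚ θ) + (AdjoinSimple.gen ℚ θ) ^ 2) : ↥ℚ⟮θ⟯) ^ 2 - 2 * ((2 * (AdjoinSimple.gen ℚ θ) - (AdjoinSimple.gen ℚ θ) ^ 2) : ↥ℚ⟮θ⟯) ^ 2 = (((((5 : ℤ) : 𝓞 ↥ℚ⟮θ⟯) + ((-9 : ℤ) : 𝓞 ↥ℚ⟮θ⟯) * b + ((3 : ℤ) : 𝓞 ↥ℚ⟮θ⟯) * b ^ 2) : 𝓞 ↥ℚ⟮θ⟯) : ↥ℚ⟮θ⟯) := by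
    rw [NumberField.RingOfIntegers.coe_eq_algebraMap]
    simp only [map_add, map_sub, map_mul, map_pow, map_intCast, map_neg, map_one, map_zero, hbgen]
    push_cast
    linear_combination ((1 : ↥ℚ⟮θ⟯) + (-1 : ↥ℚ⟮θ⟯) * (AdjoinSimple.gen ℚ θ)) * hgenrel
  have hNw2 : (Algebra.norm ℤ ((((5 : ℤ) : 𝓞 ↥ℚ⟮θ⟯) + ((-9 : ℤ) : 𝓞 ↥ℚ⟮θ⟯) * b + ((3 : ℤ) : 𝓞 ↥ℚ⟮θ⟯) * b ^ 2) : 𝓞 ↥ℚ⟮θ⟯)).natAbs = 4 := by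
    rw [natAbs_norm_coords_eq_natAbs_normPoly ↥ℚ⟮θ⟯ h3 b (p := -1) (q := -5) (r := 4) irreducible_cubic_d469p hb (5) (-9) (3)]; norm_num
  have hN2 : (Algebra.norm ℤ (3 - 3 * bA - 2 * bA * xA + bA ^ 2 + bA ^ 2 * xA : 𝓞 ↥(ℚ⟮θ⟯ ⊔ (CyclotomicZp.zpExtension 2).layer 1))).natAbs = 4 := hnorm _ _ _ _ hπ2val hn2 4 hNw2
  obtain ⟨hprime1, hres1, hP1⟩ := prime_pack _ hN1
  -- `η`: residue field `𝔽₄`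
  have hη2 : (3 - 3 * bA - 2 * bA * xA + bA ^ 2 + bA ^ 2 * xA : 𝓞 ↥(ℚ⟮θ⟯ ⊔ (CyclotomicZp.zpExtension 2).layer 1)) ∣ 2 := ⟨(18517 + 13104 * xA + 817 * bA + 572 * bA * xA - 3572 * bA ^ 2 - 2536 * bA ^ 2 * xA) * (-4 + xA + bA + bA * xA + bA ^ 2) ^ 2 * (3 - 3 * bA - 2 * bA * xA + bA ^ 2 + bA ^ 2 * xA), by linear_combination (-1 : 𝓞 ↥(ℚ⟮θ⟯ ⊔ (CyclotomicZp.zpExtension 2).layer 1)) * htwoall⟩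
  have hηζ : (3 - 3 * bA - 2 * bA * xA + bA ^ 2 + bA ^ 2 * xA : 𝓞 ↥(ℚ⟮θ⟯ ⊔ (CyclotomicZp.zpExtension 2).layer 1)) ∣ (-bA) ^ 2 + (-bA) + 1 := ⟨-9 - 4 * xA + bA - bA * xA + 3 * bA ^ 2, hzeta⟩
  have habsη : Ideal.absNorm (Ideal.span {(3 - 3 * bA - 2 * bA * xA + bA ^ 2 + bA ^ 2 * xA : 𝓞 ↥(ℚ⟮θ⟯ ⊔ (CyclotomicZp.zpExtension 2).layer 1))}) = 4 := by rw [Ideal.absNorm_span_singleton, hN2]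
  obtain ⟨hP2, hprime2⟩ := prime_of_absNorm_span_eq_four (3 - 3 * bA - 2 * bA * xA + bA ^ 2 + bA ^ 2 * xA : 𝓞 ↥(ℚ⟮θ⟯ ⊔ (CyclotomicZp.zpExtension 2).layer 1)) habsη hη2 _ hηζ
  have hone : ∀ {π y z : 𝓞 ↥(ℚ⟮θ⟯ ⊔ (CyclotomicZp.zpExtension 2).layer 1)}, Prime π → y - 1 = π * z → ¬ π ∣ y := by
    rintro π y z hπ hyz ⟨c, hc⟩
    exact hπ.not_unit (isUnit_of_dvd_one ⟨c - z, by linear_combination hc - hyz⟩)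
  refine ⟨bA, xA, sA, hbAval', rfl, ?_, RbA, RxA, hs, hsA2,
    ⟨hprime1, hres1, hone hprime1 hw1_1, hone hprime1 hmu1_1, hP1⟩, ⟨hprime2, hP2⟩⟩
  rfl

/-- **`h(ℚ(θ) ⊔ ℚ_1)` is ODD** for `θ³ + (-1)θ² + (-5)θ + (4) = 0` (`ℚ(θ, √2)`, `d = 469`): k4-w1's one-bit currency (`layerOneBit_d469p`, Chevalley's door at `2`: two primes above `2`,
a `2`-adic non-norm unit of `E`) transported to the concrete model by the kit (`odd_classNumber_sup_layer_one_of_layerOneBit`). KERNEL. [cite: Lang1990, Ch. 13 §4, Lemma 4.1] [cite: Washington1997, §13.1] -/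
theorem odd_classNumber_adjoin_sup_layer_one_d469 (hθ : aeval θ (Cubic.toPoly ⟨1, ((-1 : ℤ) : ℚ), ((-5 : ℤ) : ℚ), ((4 : ℤ) : ℚ)⟩) = 0) :
    haveI : FiniteDimensional ℚ ↥ℚ⟮θ⟯ :=
      IntermediateField.adjoin.finiteDimensional ⟨_, Cubic.monic_of_a_eq_one', by rwa [← aeval_def]⟩
    haveI : FiniteDimensional ℚ ↥((CyclotomicZp.zpExtension 2).layer 1) := (CyclotomicZp.zpExtension 2).finiteDimensional_layer_holds 1
    haveI : NumberField ↥(ℚ⟮θ⟯ ⊔ (CyclotomicZp.zpExtension 2).layer 1) := NumberField.mk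
    Odd (classNumber ↥(ℚ⟮θ⟯ ⊔ (CyclotomicZp.zpExtension 2).layer 1)) :=
  odd_classNumber_sup_layer_one_of_layerOneBit irreducible_cubic_d469p hθ (layerOneBit_d469p hθ)

end Summit.BirchSwinnertonDyer.BirchSwinnertonDyer.Theorems.AddKatoTwo

end
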